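import Summits.Schanuel.Schanuel.Theorems.RootDecomp1ETwoScale02

/-!
# RootDecomp1ETwoScale — lens 2, generation 37 «TWO-SCALE E-PLANES» (items 25020 / 31409 of route 1E at n = 4 on `InTwoScaleClass`, mod NW96 Thm 1) — continuation (RootDecomp1ETwoScale03): §3 measure helpers (section `Measure`): root package, `aeval_ne_zero_of_len_lt_den`, `pair_lower_bound` — level 0 fact-free

(lens-2 g37 `TwoScale.lean` v2 [HOME/decomp-schanuel-lens-2/g37/TwoScale.lean v2 sha256 e81e28b8…d084, 2853 l (v1 df3b5e32…, 2509 l + §5b); own farm rc 0 · 0 warn · 0 sorry · axioms std; critic VERDICT STATUS L1776 (credit E-R17, PORT GO), v2 ACK L1780]; port by census-1 gen 16 in nine parts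
`RootDecomp1ETwoScale01`–`09` — see the PORT NOTE of part 01; `--supports stmt-Schanuel-31409`; rung 0.)
-/

noncomputable section

open Complex Polynomial IntermediateField Filter

namespace Summit.Schanuel.Schanuel.Theorems.RootDecomp1ETwoScale

open Summit.Schanuel.Schanuel.Theorems.RootDecomp1KHyper
open Summit.Schanuel.Schanuel.Theorems.RootDecomp1KHyper.HyperCell
open Summit.Schanuel.Schanuel.Theorems.RootDecomp1KGeneric
open Literature.NumberTheory.Transcendental (NesterenkoWaldschmidt1996_thm_1 weilHeight₁)

variable {K : ℕ}

/-! ## §3  An algebraic-independence MEASURE for `(ρ, e^ρ)` at covered towers (mod NW96 Thm 1)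

The lens-6 engine `Generic18.logSqPairApprox_of_dependent_gen` + `Generic17.not_logSqPairApprox_of_NW`
turns an integer RELATION `Σ_k G_k(ℓ) e^{kℓ} = 0` at a log-square-Liouville `ℓ` into a contradiction with
NW96 Thm 1.  Here the same engine is made QUANTITATIVE and UNIFORM IN THE RELATION: at a covered tower `ρ`
the approximant can be taken at the scale dictated by the height `H = relLen G`, and one gets a LOWER
BOUND `|Σ_k G_k(ρ) e^{kρ}| ≥ exp(−C_{K,D,ρ} (1 + log H)^{18})` — an algebraic-independence measure of
`(ρ, e^ρ)` which is POLY-LOGARITHMIC in the height (the new ingredient: explicit Lipschitz constant,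
rational-root non-vanishing `q > |lc G_K|` instead of `denBound`, an `ε`-root package, and the bookkeeping
of the scale). -/

section Measure

/-- `1 ≤ log x` for `x ≥ 3`. -/
private theorem one_le_log_of_three_le {x : ℝ} (hx : 3 ≤ x) : 1 ≤ Real.log x := by
  rw [Real.le_log_iff_exp_le (by linarith)]
  have := Real.exp_one_lt_d9
  linarith

/-- The linear integer polynomial `q·X − p` of a rational `r = p/q` is irreducible (copy of lens 6's
private `Generic18` lemma). -/
private theorem irreducible_den_mul_X_sub_num' (r : ℚ) :
    Irreducible (C (r.den : ℤ) * X + C (-r.num) : ℤ[X]) := by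
  have hden : (r.den : ℤ) ≠ 0 := by exact_mod_cast r.den_ne_zero
  have hdeg : (C (r.den : ℤ) * X + C (-r.num) : ℤ[X]).degree = 1 := by
    rw [degree_add_eq_left_of_degree_lt] <;> rw [degree_C_mul_X hden]
    exact degree_C_le.trans_lt (by norm_num)
  have hprim : (C (r.den : ℤ) * X + C (-r.num) : ℤ[X]).IsPrimitive := by
    intro c hc
    rw [C_dvd_iff_dvd_coeff] at hc
    have h1 : c ∣ (r.den : ℤ) := by
      have := hc 1
      rwa [coeff_add, coeff_C_mul, coeff_X_one, mul_one, coeff_C, if_neg one_ne_zero,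
        add_zero] at this
    have h0 : c ∣ r.num := by
      have := hc 0
      rwa [coeff_add, coeff_C_mul, coeff_X_zero, mul_zero, zero_add, coeff_C_zero, dvd_neg] at this
    obtain ⟨u, v, huv⟩ := Rat.isCoprime_num_den r
    exact isUnit_of_dvd_one
      (huv ▸ dvd_add (dvd_mul_of_dvd_right h0 u) (dvd_mul_of_dvd_right h1 v))
  rw [hprim.irreducible_iff_irreducible_map_fraction_map (K := ℚ)]
  apply irreducible_of_degree_eq_one
  rwa [degree_map_eq_of_injective (algebraMap ℤ ℚ).injective_int]

/-- `q·X − p` has degree `1`, root `r`, and Mahler measure `max(|p|, q)` (copy of lens 6's private lemma). -/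
private theorem linear_poly_facts (r : ℚ) :
    (C (r.den : ℤ) * X + C (-r.num) : ℤ[X]).natDegree = 1 ∧
      aeval ((r : ℝ) : ℂ) (C (r.den : ℤ) * X + C (-r.num) : ℤ[X]) = 0 ∧
      ((C (r.den : ℤ) * X + C (-r.num) : ℤ[X]).map (Int.castRingHom ℂ)).mahlerMeasure =
        max (|(r.num : ℝ)|) (r.den : ℝ) := by
  have hden : (r.den : ℤ) ≠ 0 := by exact_mod_cast r.den_ne_zero
  refine ⟨by rw [natDegree_add_C, natDegree_C_mul_X _ hden], ?_, ?_⟩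
  · rw [Complex.ofReal_ratCast, map_add, map_mul, aeval_X, aeval_C, aeval_C, algebraMap_int_eq,
      eq_intCast, eq_intCast, Int.cast_neg, Int.cast_natCast]
    have : (r : ℂ) * (r.den : ℂ) = (r.num : ℂ) := by exact_mod_cast Rat.mul_den_eq_num r
    linear_combination this
  · have hmap : (C (r.den : ℤ) * X + C (-r.num) : ℤ[X]).map (Int.castRingHom ℂ) =
        C (r.den : ℂ) * X + C (-(r.num : ℂ)) := by
      simp [Polynomial.map_add, Polynomial.map_mul]
    rw [hmap, mahlerMeasure_C_mul_X_add_C (by exact_mod_cast r.den_ne_zero), norm_neg,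
      Complex.norm_natCast, Complex.norm_intCast, max_comm]

/-- The Mahler measure of a non-zero integer polynomial (over `ℂ`) is at least `1`. -/
private theorem one_le_mahlerMeasure_int {R : ℤ[X]} (hR : R ≠ 0) :
    1 ≤ (R.map (Int.castRingHom ℂ)).mahlerMeasure := by
  refine one_le_mahlerMeasure_of_one_le_norm_leadingCoeff ?_
  rw [Polynomial.leadingCoeff_map_of_injective (RingHom.injective_int _), eq_intCast,
    Complex.norm_intCast]
  exact_mod_cast Int.one_le_abs (Polynomial.leadingCoeff_ne_zero.mpr hR)

/-- **Explicit Lipschitz bound, one polynomial**: `|g(z) − g(ρ)| ≤ len(g) · D (|ρ|+2)^D · |z − ρ|` on the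
unit disc about the real point `ρ` (`deg g ≤ D`). -/
theorem norm_aeval_sub_aeval_le (g : ℤ[X]) {D : ℕ} (hD : g.natDegree ≤ D) (ρ : ℝ) {z : ℂ}
    (hz : ‖z - (ρ : ℂ)‖ ≤ 1) :
    ‖aeval z g - aeval (ρ : ℂ) g‖ ≤ (len g : ℝ) * ((D : ℝ) * (|ρ| + 2) ^ D) * ‖z - (ρ : ℂ)‖ := by
  have hρn : ‖(ρ : ℂ)‖ = |ρ| := by rw [Complex.norm_real, Real.norm_eq_abs]
  have hzn : ‖z‖ ≤ |ρ| + 1 := by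
    calc ‖z‖ = ‖(z - ρ) + ρ‖ := by rw [sub_add_cancel]
      _ ≤ ‖z - ρ‖ + ‖(ρ : ℂ)‖ := norm_add_le _ _
      _ ≤ 1 + |ρ| := by rw [hρn]; linarith
      _ = |ρ| + 1 := by ring
  have hM : max 1 (max ‖z‖ ‖(ρ : ℂ)‖) ≤ |ρ| + 2 := by
    rw [hρn]
    exact max_le (by linarith [abs_nonneg ρ]) (max_le (by linarith) (by linarith [abs_nonneg ρ]))
  have hM0 : 0 ≤ max 1 (max ‖z‖ ‖(ρ : ℂ)‖) := le_trans zero_le_one (le_max_left _ _)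
  have hR1 : 1 ≤ |ρ| + 2 := by linarith [abs_nonneg ρ]
  rw [aeval_eq_sum_range z, aeval_eq_sum_range (ρ : ℂ), ← Finset.sum_sub_distrib]
  calc ‖∑ i ∈ Finset.range (g.natDegree + 1), (g.coeff i • z ^ i - g.coeff i • (ρ : ℂ) ^ i)‖
      ≤ ∑ i ∈ Finset.range (g.natDegree + 1), ‖g.coeff i • z ^ i - g.coeff i • (ρ : ℂ) ^ i‖ :=
        norm_sum_le _ _
    _ ≤ ∑ i ∈ Finset.range (g.natDegree + 1),
          |(g.coeff i : ℝ)| * (((D : ℝ) * (|ρ| + 2) ^ D) * ‖z - (ρ : ℂ)‖) := by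
        refine Finset.sum_le_sum fun i hi => ?_
        have hiD : i ≤ D := by have := Finset.mem_range.mp hi; omega
        rw [← smul_sub, zsmul_eq_mul, norm_mul, Complex.norm_intCast]
        refine mul_le_mul_of_nonneg_left ?_ (abs_nonneg _)
        calc ‖z ^ i - (ρ : ℂ) ^ i‖ ≤ i * (max 1 (max ‖z‖ ‖(ρ : ℂ)‖)) ^ i * ‖z - (ρ : ℂ)‖ :=
              norm_pow_sub_pow_le z ρ i
          _ ≤ (D : ℝ) * (|ρ| + 2) ^ D * ‖z - (ρ : ℂ)‖ := by
              refine mul_le_mul_of_nonneg_right ?_ (norm_nonneg _)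
              have h1 : (i : ℝ) ≤ D := by exact_mod_cast hiD
              have h2 : (max 1 (max ‖z‖ ‖(ρ : ℂ)‖)) ^ i ≤ (|ρ| + 2) ^ D :=
                (pow_le_pow_left₀ hM0 hM i).trans (pow_le_pow_right₀ hR1 hiD)
              exact mul_le_mul h1 h2 (by positivity) (by positivity)
          _ = ((D : ℝ) * (|ρ| + 2) ^ D) * ‖z - (ρ : ℂ)‖ := by ring
    _ = (len g : ℝ) * ((D : ℝ) * (|ρ| + 2) ^ D) * ‖z - (ρ : ℂ)‖ := by
        rw [← Finset.sum_mul, len]; push_cast; ring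

/-- **Explicit Lipschitz constant of `z ↦ Σ_k G_k(z) w^k`** on the unit disc about `ρ`:
`Λ = D (|ρ|+2)^D · max(1,|w|)^K · relLen G` — LINEAR in the height `relLen G`. -/
theorem lipschitz_sliceAt (G : Fin (K + 1) → ℤ[X]) {D : ℕ} (hD : ∀ k, (G k).natDegree ≤ D) (w : ℂ)
    (ρ : ℝ) {z : ℂ} (hz : ‖z - (ρ : ℂ)‖ ≤ 1) :
    ‖(sliceAt G w).eval z - (sliceAt G w).eval (ρ : ℂ)‖ ≤
      ((D : ℝ) * (|ρ| + 2) ^ D * max 1 ‖w‖ ^ K * relLen G) * ‖z - (ρ : ℂ)‖ := by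
  have hm1 : (1 : ℝ) ≤ max 1 ‖w‖ := le_max_left _ _
  rw [eval_sliceAt, eval_sliceAt, ← Finset.sum_sub_distrib]
  calc ‖∑ k : Fin (K + 1), (aeval z (G k) * w ^ (k : ℕ) - aeval (ρ : ℂ) (G k) * w ^ (k : ℕ))‖
      ≤ ∑ k : Fin (K + 1), ‖aeval z (G k) * w ^ (k : ℕ) - aeval (ρ : ℂ) (G k) * w ^ (k : ℕ)‖ :=
        norm_sum_le _ _
    _ ≤ ∑ k : Fin (K + 1), (len (G k) : ℝ) *
          (((D : ℝ) * (|ρ| + 2) ^ D) * ‖z - (ρ : ℂ)‖ * max 1 ‖w‖ ^ K) := by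
        refine Finset.sum_le_sum fun k _ => ?_
        rw [← sub_mul, norm_mul, norm_pow]
        have h1 := norm_aeval_sub_aeval_le (G k) (hD k) ρ hz
        have h2 : ‖w‖ ^ (k : ℕ) ≤ max 1 ‖w‖ ^ K :=
          (pow_le_pow_left₀ (norm_nonneg _) (le_max_right _ _) _).trans
            (pow_le_pow_right₀ hm1 (Nat.lt_succ_iff.mp k.isLt))
        have hl : (0 : ℝ) ≤ len (G k) := by exact_mod_cast len_nonneg (G k)
        have h0 : 0 ≤ (len (G k) : ℝ) * ((D : ℝ) * (|ρ| + 2) ^ D) * ‖z - (ρ : ℂ)‖ :=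
          mul_nonneg (mul_nonneg hl (by positivity)) (norm_nonneg _)
        calc ‖aeval z (G k) - aeval (ρ : ℂ) (G k)‖ * ‖w‖ ^ (k : ℕ)
            ≤ ((len (G k) : ℝ) * ((D : ℝ) * (|ρ| + 2) ^ D) * ‖z - (ρ : ℂ)‖) * max 1 ‖w‖ ^ K :=
              mul_le_mul h1 h2 (by positivity) h0
          _ = _ := by ring
    _ = ((D : ℝ) * (|ρ| + 2) ^ D * max 1 ‖w‖ ^ K * relLen G) * ‖z - (ρ : ℂ)‖ := by
        rw [← Finset.sum_mul, relLen]; ring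

/-- **Rational-root non-vanishing**: an integer polynomial `g ≠ 0` has no rational root whose denominator
exceeds `len g ≥ |lc g|` (the rational root theorem: `q ∣ lc g`). -/
theorem aeval_ne_zero_of_len_lt_den {g : ℤ[X]} (hg : g ≠ 0) {r : ℚ} (hq : len g < (r.den : ℤ)) :
    aeval r g ≠ 0 := by
  intro h0
  set e : ℕ := g.natDegree with he
  have hcast := scaleEval_cast (F := ℚ) g le_rfl r.num r.den_nz
  rw [Rat.num_div_den, h0, mul_zero] at hcast
  have hS : scaleEval g e r.num r.den = 0 := by exact_mod_cast hcast
  unfold scaleEval at hS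
  rw [Finset.sum_range_succ, Nat.sub_self, pow_zero, mul_one] at hS
  have hdvd : (r.den : ℤ) ∣ ∑ i ∈ Finset.range e, g.coeff i * r.num ^ i * (r.den : ℤ) ^ (e - i) :=
    Finset.dvd_sum fun i hi => by
      have : e - i ≠ 0 := by have := Finset.mem_range.mp hi; omega
      exact Dvd.dvd.mul_left (dvd_pow_self (r.den : ℤ) this) _
  have hdvd' : (r.den : ℤ) ∣ g.coeff e * r.num ^ e := by
    have : g.coeff e * r.num ^ e =
        -(∑ i ∈ Finset.range e, g.coeff i * r.num ^ i * (r.den : ℤ) ^ (e - i)) := by linarith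
    rw [this]; exact (dvd_neg).mpr hdvd
  have hcop : IsCoprime (r.den : ℤ) (r.num ^ e) := (Rat.isCoprime_num_den r).symm.pow_right
  have hqdvd : (r.den : ℤ) ∣ g.coeff e := hcop.dvd_of_dvd_mul_right hdvd'
  have hlc : g.coeff e ≠ 0 := Polynomial.leadingCoeff_ne_zero.mpr hg
  have hle : (r.den : ℤ) ≤ |g.coeff e| := Int.le_of_dvd (abs_pos.mpr hlc) ((dvd_abs _ _).mpr hqdvd)
  have := abs_coeff_le_len g e
  omega

/-- **`ε`-root package** (`Generic05.root_package` with the relation `= 0` replaced by its VALUE `ε` and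
`denBound` replaced by the non-vanishing hypothesis): `A_q = specY G D p q ≠ 0` has degree `K` and a root
`y` with `‖w − y‖^K ≤ q^D (Λ |ρ − r| + ε)`, `ε = |Σ_k G_k(ρ) w^k|`. -/
theorem root_package_eps (G : Fin (K + 1) → ℤ[X]) (hK : 0 < K) {D : ℕ}
    (hD : ∀ k, (G k).natDegree ≤ D) {ρ : ℝ} {w : ℂ} {Λ : ℝ}
    (hΛ : ∀ z : ℂ, ‖z - (ρ : ℂ)‖ ≤ 1 →
      ‖(sliceAt G w).eval z - (sliceAt G w).eval (ρ : ℂ)‖ ≤ Λ * ‖z - (ρ : ℂ)‖)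
    (r : ℚ) (h0 : scaleEval (G (Fin.last K)) D r.num r.den ≠ 0) (hr1 : |ρ - r| ≤ 1) :
    specY G D r.num r.den ≠ 0 ∧ (specY G D r.num r.den).natDegree = K ∧
      ∃ y : ℂ, aeval y (specY G D r.num r.den) = 0 ∧
        ‖w - y‖ ^ K ≤ (r.den : ℝ) ^ D *
          (Λ * |ρ - r| + ‖∑ k : Fin (K + 1), aeval (ρ : ℂ) (G k) * w ^ (k : ℕ)‖) := by
  have hA0 := specY_ne_zero G D r.num r.den h0
  have hdeg := natDegree_specY_eq G D r.num r.den h0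
  refine ⟨hA0, hdeg, ?_⟩
  obtain ⟨y, hy, hle⟩ := exists_root_int_pow_le (specY G D r.num r.den) (by rw [hdeg]; exact hK) w
  refine ⟨y, hy, ?_⟩
  rw [hdeg] at hle
  refine hle.trans ?_
  rw [aeval_specY G hD r.num r.den_nz w, ← eval_sliceAt, norm_mul, Complex.norm_pow,
    Complex.norm_natCast]
  refine mul_le_mul_of_nonneg_left ?_ (by positivity)
  have hpq : ((r.num : ℤ) : ℂ) / ((r.den : ℕ) : ℂ) = ((r : ℝ) : ℂ) := (ratCast_eq_num_div_den r).symm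
  have hdist : ‖(((r : ℝ) : ℂ)) - (ρ : ℂ)‖ = |ρ - r| := by
    rw [← Complex.ofReal_sub, Complex.norm_real, Real.norm_eq_abs, abs_sub_comm]
  have h1 := hΛ ((r : ℝ) : ℂ) (by rw [hdist]; exact hr1)
  rw [hdist] at h1
  rw [hpq]
  have hρ : (sliceAt G w).eval (ρ : ℂ) = ∑ k, aeval (ρ : ℂ) (G k) * w ^ (k : ℕ) := eval_sliceAt G w ρ
  calc ‖(sliceAt G w).eval ((r : ℝ) : ℂ)‖
      = ‖((sliceAt G w).eval ((r : ℝ) : ℂ) - (sliceAt G w).eval (ρ : ℂ)) +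
          (sliceAt G w).eval (ρ : ℂ)‖ := by
        rw [sub_add_cancel]
    _ ≤ ‖(sliceAt G w).eval ((r : ℝ) : ℂ) - (sliceAt G w).eval (ρ : ℂ)‖ +
          ‖(sliceAt G w).eval (ρ : ℂ)‖ :=
        norm_add_le _ _
    _ ≤ Λ * |ρ - r| + ‖(sliceAt G w).eval (ρ : ℂ)‖ := by linarith [h1]
    _ = Λ * |ρ - r| + ‖∑ k, aeval (ρ : ℂ) (G k) * w ^ (k : ℕ)‖ := by rw [hρ]

/-- **The NW clash, quantitative** (the positive content of lens 6's `not_logSqPairApprox_of_NW`): at degree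
`deg S · deg f ≤ N₀` and heights `log M ≤ c log q` (`c ≥ 0`, `q ≥ 3`) the two-parameter measure of
`(u, e^u)` is `exp(−c_NW₂(|u|) (N₀+1)⁵ (2+c)² (log q)²)`. -/
theorem pair_lower_bound (hNW : NesterenkoWaldschmidt1996_thm_1) {u : ℂ} (hu0 : u ≠ 0) {N₀ : ℕ}
    {c : ℝ} (hc0 : 0 ≤ c) {q : ℕ} (hq3 : 3 ≤ q) {f S : ℤ[X]} {α β : ℂ} (hfirr : Irreducible f)
    (hfdeg : 0 < f.natDegree) (hS0 : S ≠ 0) (hβf : aeval β f = 0) (hαS : aeval α S = 0)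
    (hα0 : α ≠ 0) (hβ0 : β ≠ 0) (hdeg : S.natDegree * f.natDegree ≤ N₀)
    (hMS : Real.log (S.map (Int.castRingHom ℂ)).mahlerMeasure ≤ c * Real.log q)
    (hMf : Real.log (f.map (Int.castRingHom ℂ)).mahlerMeasure ≤ c * Real.log q) :
    Real.exp (-(cNW₂ ‖u‖ * ((N₀ : ℝ) + 1) ^ 5 * (2 + c) ^ 2 * Real.log q ^ 2)) ≤
      ‖cexp u - α‖ + ‖u - β‖ := by
  have hq3r : (3 : ℝ) ≤ q := by exact_mod_cast hq3
  have hlog1 : 1 ≤ Real.log q := one_le_log_of_three_le hq3r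
  have hlog0 : 0 ≤ Real.log q := by linarith
  obtain ⟨hαalg, hβalg, hD1, hDle, hhα, hhβ⟩ := pair_bounds f hfirr hfdeg hβf S hS0 hαS
  have hN1 : (1 : ℝ) ≤ (N₀ : ℝ) + 1 := by linarith [(Nat.cast_nonneg N₀ : (0 : ℝ) ≤ N₀)]
  have hDN : (Module.finrank ℚ ↥(IntermediateField.adjoin ℚ ({α, β} : Set ℂ)) : ℝ) ≤ (N₀ : ℝ) + 1 := by
    have : Module.finrank ℚ ↥(IntermediateField.adjoin ℚ ({α, β} : Set ℂ)) ≤ N₀ := hDle.trans hdeg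
    have : (Module.finrank ℚ ↥(IntermediateField.adjoin ℚ ({α, β} : Set ℂ)) : ℝ) ≤ N₀ := by
      exact_mod_cast this
    linarith
  have hL1 : (1 : ℝ) ≤ 1 + c * Real.log q := by nlinarith
  have hhα' : weilHeight₁ (IntermediateField.adjoin ℚ ({α, β} : Set ℂ)) (fun _ : Unit => α) ≤
      1 + c * Real.log q := by linarith
  have hhβ' : weilHeight₁ (IntermediateField.adjoin ℚ ({α, β} : Set ℂ)) (fun _ : Unit => β) ≤
      1 + c * Real.log q := by linarith
  have hlow := expPair_lower_bound_deg_height hNW hu0 hα0 hβ0 hαalg hβalg hN1 hL1 hDN hhα' hhβ'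
  have hsq : (1 + (1 + c * Real.log q)) ^ 2 ≤ (2 + c) ^ 2 * Real.log q ^ 2 := by
    have h1 : 1 + (1 + c * Real.log q) ≤ (2 + c) * Real.log q := by nlinarith
    have h0 : 0 ≤ 1 + (1 + c * Real.log q) := by nlinarith
    calc (1 + (1 + c * Real.log q)) ^ 2 ≤ ((2 + c) * Real.log q) ^ 2 := pow_le_pow_left₀ h0 h1 2
      _ = (2 + c) ^ 2 * Real.log q ^ 2 := by ring
  have hκle : cNW₂ ‖u‖ * ((N₀ : ℝ) + 1) ^ 5 * (1 + (1 + c * Real.log q)) ^ 2 ≤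
      cNW₂ ‖u‖ * ((N₀ : ℝ) + 1) ^ 5 * (2 + c) ^ 2 * Real.log q ^ 2 := by
    have h0 : 0 ≤ cNW₂ ‖u‖ * ((N₀ : ℝ) + 1) ^ 5 := by
      have := cNW₂_pos (norm_nonneg u); positivity
    calc cNW₂ ‖u‖ * ((N₀ : ℝ) + 1) ^ 5 * (1 + (1 + c * Real.log q)) ^ 2
        ≤ cNW₂ ‖u‖ * ((N₀ : ℝ) + 1) ^ 5 * ((2 + c) ^ 2 * Real.log q ^ 2) :=
          mul_le_mul_of_nonneg_left hsq h0
      _ = _ := by ring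
  exact le_trans (Real.exp_le_exp.mpr (neg_le_neg hκle)) hlow

/-- The size constant `A = log(|ρ| + 2) + 1` (`log(|p| + q) ≤ A log q`). -/
def cA (ρ : ℝ) : ℝ := Real.log (|ρ| + 2) + 1

/-- The height slope `c(H) = log(K+1) + log H + (D+1)A + 2A` (`log M(A_q), log M(qX − p) ≤ c(H) log q`). -/
def cHt (ρ : ℝ) (K D : ℕ) (H : ℝ) : ℝ :=
  Real.log ((K : ℝ) + 1) + Real.log H + ((D : ℝ) + 1) * cA ρ + 2 * cA ρ

/-- The NW exponent `κ(H) = c_NW₂(|ρ|) (K+1)⁵ (2 + c(H))²`. -/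
def cKap (ρ : ℝ) (K D : ℕ) (H : ℝ) : ℝ := cNW₂ |ρ| * ((K : ℝ) + 1) ^ 5 * (2 + cHt ρ K D H) ^ 2

/-- The quality index `i(H) = K (κ(H) + 4) + D + 2` demanded of the approximant at the working scale. -/
def cIdx (ρ : ℝ) (K D : ℕ) (H : ℝ) : ℝ := (K : ℝ) * (cKap ρ K D H + 4) + D + 2

/-- `1 ≤ A`. -/
theorem one_le_cA (ρ : ℝ) : 1 ≤ cA ρ := by
  have : 0 ≤ Real.log (|ρ| + 2) := Real.log_nonneg (by linarith [abs_nonneg ρ])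
  unfold cA; linarith

/-- `0 ≤ c(H)` for `H ≥ 1`. -/
theorem cHt_nonneg (ρ : ℝ) (K D : ℕ) {H : ℝ} (hH : 1 ≤ H) : 0 ≤ cHt ρ K D H := by
  have h1 : 0 ≤ Real.log ((K : ℝ) + 1) := Real.log_nonneg (by linarith [(Nat.cast_nonneg K : (0:ℝ) ≤ K)])
  have h2 : 0 ≤ Real.log H := Real.log_nonneg hH
  have h3 := one_le_cA ρ
  have h4 : 0 ≤ ((D : ℝ) + 1) * cA ρ := by positivity
  unfold cHt; linarith

/-- `0 ≤ κ(H)`. -/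
theorem cKap_nonneg (ρ : ℝ) (K D : ℕ) (H : ℝ) : 0 ≤ cKap ρ K D H := by
  have := cNW₂_pos (abs_nonneg ρ); unfold cKap; positivity

/-- `D + 2 ≤ i(H)` and `0 ≤ i(H)`. -/
theorem cIdx_ge (ρ : ℝ) (K D : ℕ) (H : ℝ) : (D : ℝ) + 2 ≤ cIdx ρ K D H := by
  have := cKap_nonneg ρ K D H
  have : 0 ≤ (K : ℝ) * (cKap ρ K D H + 4) := by positivity
  unfold cIdx; linarith

end Measure

end Summit.Schanuel.Schanuel.Theorems.RootDecomp1ETwoScale
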